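import Summits.CriticalPhenomena.PercolationContinuityZ3.Theorems.PercNearOneGluingNoHeavyLowerTailSunflowerCoreCounts
import Summits.CriticalPhenomena.PercolationContinuityZ3.Theorems.PercNearOneGluingNoHeavyLowerTailSunflowerCenteredPetal
import HarnessLib

/-!
# `NoHeavyLowerTail` (crux stmt-CriticalPhenomena-4575), abstract sunflower cubic: the PETAL-SPECTATOR identity,
# the census-true SPECTATOR-TRANSFER inequality (proved behind a centred petal; quantitative form of ★ behind an
# intersecting petal), and the BLOCK-WEIGHTED partition lemma (typed conjectures + reductions)

Support file (seat `prim-ineq-gen-2` gen 22; `--supports stmt-CriticalPhenomena-4575`).  Nothing is asserted about the crux; no `sorry`,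
no named facts; the two `@[conjecture]` definitions are obligations of our theory, never facts.  Memo:
run/shared/lean/prim/prim-ineq-gen-2/SPECTATOR-TRANSFER-GEN22.md.

SETTING (tree: `…SunflowerAntipodalGladkov`, `…SunflowerPartitionLemma`, `…SunflowerSpectatorRows`, `…SunflowerPurePayer`,
`…SunflowerCoreCounts`).  `F : Sunflower α` = monotone map `lab : 2^α → M₃` (`0` bottom `B`, `1,2,3` petals `C_i`, `4` kernel `A`);
`Sw w = Σ_{(P¹,P²,P³)} w (lab P¹) · kk (lab P²) (lab P³)` over ordered 3-partitions (`Sw_nonneg` for `w ≥ 0` = antipodal Gladkov);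
`SA = Sw 1_{4}`, `SB = Sw 1_{0}`; `ZH = 3(SA + SB) − Ntri` (`ZH_eq_SA_SB`), `Ntri` = number of ordered rainbow partitions.

NEW HERE.
* `Nabk k = #{(P¹,P²,P³) : lab = (4, 0, k)}`, `Nkk k = #{lab P¹ = lab P² = k}`, `NkkForeign k` = those with `P³` in a petal `≠ k`.
* **PETAL-SPECTATOR IDENTITY** (`three_Sw_petal_eq`): for a petal label `k`,
      `3 · Sw 1_{k} = 6 · Nabk k − Ntri − 6 · NkkForeign k`
  (the Gladkov surplus behind a petal-`k` spectator sees `(A,B)` pairs positively and rainbow / `(k, j)` pairs negatively); hence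
  `Ntri + 6·NkkForeign k ≤ 6·Nabk k` (`Ntri_le_six_Nabk`).
* **CONJECTURE `SpectatorTransfer`** (census-true, this work): for every petal label `k`,
      `2 · Nabk k ≤ SA + SB + 2 · Nkk k`,
  i.e. the kernel- and bottom-spectator surplus, helped by the `(C_k,C_k,·)` partitions, dominates the `(A,B,C_k)` count.  Equivalent form
  (`ZH_ge_of_spectatorTransfer`): `ZH ≥ 3·Sw 1_{k} − 6·(Nkk k − NkkForeign k)` — the ★-slack is at least the petal-`k` spectator surplus minus six
  times the number of `(C_k,C_k,X)` partitions with `X ∈ {A,B,C_k}`.  Behind an INTERSECTING petal (`Nkk k = 0`) it gives `ZH ≥ 3·Sw 1_{k} ≥ 0`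
  (`ZH_nonneg_of_spectatorTransfer_of_Nkk_eq_zero`): a quantitative version of prim-l12-p2's IX-gen theorem (`…SunflowerHallGladkovProof`).
  PROVED HERE behind a CENTRED petal (`spectatorTransfer_one_of_centered`, from l12-p2's `two_N140_le_SB_of_centered`, since `Nabk 1 = N140`).
  CENSUS (memo §2): 0 violations on all sunflowers on ≤ 5 points (275,665,902 maps × 3 labels), all nested up-set pairs on ≤ 5 points in
  finest-structure form (7,828,354; every component), all 3-terminal multigraphs `nv ≤ 5, m ≤ 6` and their duals, 4.7·10⁵ hill-climbed θ-pullbacks on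
  7–9 points, the families TH(2..6), CS(2), CS(3), CS(2,3,3), doubled/tripled star, witness7; tight in a large fraction of small instances.
  Related no-gos (memo §2): `SA + SB ≥ min_k (2·Nabk k − 2·NkkForeign k)` FAILS (tripled star, 9 points); every per-window split of the inequality fails.
* **CONJECTURE `WeightedPartitionLemma`** (census-true, this work): for all block weights `w₁,w₂,w₃ ∈ ℕ`,
      `0 ≤ ZHw w₁ w₂ w₃ := Σ_{(P¹,P²,P³)} s6H (lab P¹) (lab P²) (lab P³) · w₁^{#P¹} w₂^{#P²} w₃^{#P³}`,
  i.e. the `H`-row cubic has nonnegative mean under EVERY i.i.d. (not only the uniform) assignment of points to the three blocks.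
  `ZHw 1 1 1 = ZH` (`ZHw_one`), so it implies ★ (`partitionLemmaH_of_weighted`); for `w₃ = 0` it is the two-copy row
  `2·n_{AA} + 2·n_{AB} ≥ n_{petal,petal'}` (antipodal Gladkov).  CENSUS (memo §3): all sunflowers on ≤ 5 points × ten weight vectors up to
  (1,10,100), the families above and their duals: 0 violations; per-point (non-constant) weights are FALSE (a single rainbow partition).
  For `Π₃` (`m = 3`): `ZHw 1 1 t = 2(t−1)²(t+2)`.
-/

namespace Summit.CriticalPhenomena.PercolationContinuityZ3.Theorems.SunflowerPartition

open Finset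

variable {α : Type*} [Fintype α] [DecidableEq α]

namespace Sunflower

variable (F : Sunflower α)

/-! ## The three counts -/

/-- `Nabk k` = number of ordered 3-partitions labelled `(kernel, bottom, k)`. [this work] -/
def Nabk (k : Fin 5) : ℤ :=
  ∑ q ∈ parts α, (if F.lab q.1 = 4 ∧ F.lab q.2 = 0 ∧ F.lab (q.1 ∪ q.2)ᶜ = k then (1 : ℤ) else 0)

/-- `Nkk k` = number of ordered 3-partitions whose first two blocks both carry the label `k` (third block arbitrary). [this work] -/
def Nkk (k : Fin 5) : ℤ :=
  ∑ q ∈ parts α, (if F.lab q.1 = k ∧ F.lab q.2 = k then (1 : ℤ) else 0)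

/-- `NkkForeign k` = number of ordered 3-partitions labelled `(k, k, j)` with `j` a PETAL label different from `k`. [this work] -/
def NkkForeign (k : Fin 5) : ℤ :=
  ∑ q ∈ parts α, (if F.lab q.1 = k ∧ F.lab q.2 = k ∧
      (F.lab (q.1 ∪ q.2)ᶜ ≠ 0 ∧ F.lab (q.1 ∪ q.2)ᶜ ≠ 4 ∧ F.lab (q.1 ∪ q.2)ᶜ ≠ k) then (1 : ℤ) else 0)

/-- `Nabk k ≥ 0`. [this work] -/
theorem Nabk_nonneg (k : Fin 5) : 0 ≤ F.Nabk k :=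
  sum_nonneg fun _ _ => by split_ifs <;> norm_num

/-- `Nkk k ≥ 0`. [this work] -/
theorem Nkk_nonneg (k : Fin 5) : 0 ≤ F.Nkk k :=
  sum_nonneg fun _ _ => by split_ifs <;> norm_num

/-- `NkkForeign k ≥ 0`. [this work] -/
theorem NkkForeign_nonneg (k : Fin 5) : 0 ≤ F.NkkForeign k :=
  sum_nonneg fun _ _ => by split_ifs <;> norm_num

/-- `NkkForeign k ≤ Nkk k`. [this work] -/
theorem NkkForeign_le_Nkk (k : Fin 5) : F.NkkForeign k ≤ F.Nkk k :=
  sum_le_sum fun _ _ => by split_ifs <;> simp_all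

/-- `Nabk 1 = N140` (the tree's count of `(C₁, A, B)` partitions, `…SunflowerPrincipalPetal`), by a cyclic relabelling of the blocks. [this work] -/
theorem Nabk_one_eq_N140 : F.Nabk 1 = F.N140 := by
  unfold Nabk N140
  rw [sum_parts_cyc' (α := α) (fun a b c => if F.lab a = 4 ∧ F.lab b = 0 ∧ F.lab c = 1 then (1 : ℤ) else 0)]
  refine sum_congr rfl fun q _ => ?_
  by_cases h : F.lab q.2 = 4 ∧ F.lab (q.1 ∪ q.2)ᶜ = 0 ∧ F.lab q.1 = 1
  · rw [if_pos h, if_pos ⟨h.2.2, h.1, h.2.1⟩]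
  · rw [if_neg h, if_neg (fun h' => h ⟨h'.2.1, h'.2.2, h'.1⟩)]

/-! ## The petal-spectator identity -/

/-- The pointwise kernel identity behind `three_Sw_petal_eq` (checked by `decide` for the three petal labels): the `S₃`-symmetrised
petal-`k` spectator kernel equals the symmetrised `(4,0,k)` indicator minus the rainbow indicator minus the symmetrised
`(k,k,foreign)` indicator (symmetrisations in the block order of `sum_parts_symm6`). [this work] -/
theorem petal_kernel_identity : ∀ k : Fin 5, k ≠ 0 → k ≠ 4 → ∀ x y z : Fin 5,
    (if x = k then (1 : ℤ) else 0) * kk y z + (if y = k then (1 : ℤ) else 0) * kk x z + (if z = k then (1 : ℤ) else 0) * kk x y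
      = ((if x = 4 ∧ y = 0 ∧ z = k then (1 : ℤ) else 0) + (if x = 4 ∧ z = 0 ∧ y = k then (1 : ℤ) else 0)
          + (if y = 4 ∧ x = 0 ∧ z = k then (1 : ℤ) else 0) + (if y = 4 ∧ z = 0 ∧ x = k then (1 : ℤ) else 0)
          + (if z = 4 ∧ x = 0 ∧ y = k then (1 : ℤ) else 0) + (if z = 4 ∧ y = 0 ∧ x = k then (1 : ℤ) else 0))
        - triP x y z
        - ((if x = k ∧ y = k ∧ (z ≠ 0 ∧ z ≠ 4 ∧ z ≠ k) then (1 : ℤ) else 0) + (if x = k ∧ z = k ∧ (y ≠ 0 ∧ y ≠ 4 ∧ y ≠ k) then (1 : ℤ) else 0)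
          + (if y = k ∧ x = k ∧ (z ≠ 0 ∧ z ≠ 4 ∧ z ≠ k) then (1 : ℤ) else 0) + (if y = k ∧ z = k ∧ (x ≠ 0 ∧ x ≠ 4 ∧ x ≠ k) then (1 : ℤ) else 0)
          + (if z = k ∧ x = k ∧ (y ≠ 0 ∧ y ≠ 4 ∧ y ≠ k) then (1 : ℤ) else 0) + (if z = k ∧ y = k ∧ (x ≠ 0 ∧ x ≠ 4 ∧ x ≠ k) then (1 : ℤ) else 0)) := by
  decide

/-- **PETAL-SPECTATOR IDENTITY**: for a petal label `k`, `3 · Sw 1_{k} = 6 · Nabk k − Ntri − 6 · NkkForeign k`. [this work] -/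
theorem three_Sw_petal_eq (k : Fin 5) (hk0 : k ≠ 0) (hk4 : k ≠ 4) :
    3 * F.Sw (fun v => if v = k then 1 else 0) = 6 * F.Nabk k - F.Ntri - 6 * F.NkkForeign k := by
  have e1 : 6 * F.Nabk k = ∑ q ∈ parts α,
      ((if F.lab q.1 = 4 ∧ F.lab q.2 = 0 ∧ F.lab (q.1 ∪ q.2)ᶜ = k then (1 : ℤ) else 0)
        + (if F.lab q.1 = 4 ∧ F.lab (q.1 ∪ q.2)ᶜ = 0 ∧ F.lab q.2 = k then (1 : ℤ) else 0)
        + (if F.lab q.2 = 4 ∧ F.lab q.1 = 0 ∧ F.lab (q.1 ∪ q.2)ᶜ = k then (1 : ℤ) else 0)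
        + (if F.lab q.2 = 4 ∧ F.lab (q.1 ∪ q.2)ᶜ = 0 ∧ F.lab q.1 = k then (1 : ℤ) else 0)
        + (if F.lab (q.1 ∪ q.2)ᶜ = 4 ∧ F.lab q.1 = 0 ∧ F.lab q.2 = k then (1 : ℤ) else 0)
        + (if F.lab (q.1 ∪ q.2)ᶜ = 4 ∧ F.lab q.2 = 0 ∧ F.lab q.1 = k then (1 : ℤ) else 0)) := by
    unfold Nabk
    exact sum_parts_symm6 (fun x y z => if x = 4 ∧ y = 0 ∧ z = k then (1 : ℤ) else 0) F
  have e2 : 6 * F.NkkForeign k = ∑ q ∈ parts α,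
      ((if F.lab q.1 = k ∧ F.lab q.2 = k ∧ (F.lab (q.1 ∪ q.2)ᶜ ≠ 0 ∧ F.lab (q.1 ∪ q.2)ᶜ ≠ 4 ∧ F.lab (q.1 ∪ q.2)ᶜ ≠ k) then (1 : ℤ) else 0)
        + (if F.lab q.1 = k ∧ F.lab (q.1 ∪ q.2)ᶜ = k ∧ (F.lab q.2 ≠ 0 ∧ F.lab q.2 ≠ 4 ∧ F.lab q.2 ≠ k) then (1 : ℤ) else 0)
        + (if F.lab q.2 = k ∧ F.lab q.1 = k ∧ (F.lab (q.1 ∪ q.2)ᶜ ≠ 0 ∧ F.lab (q.1 ∪ q.2)ᶜ ≠ 4 ∧ F.lab (q.1 ∪ q.2)ᶜ ≠ k) then (1 : ℤ) else 0)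
        + (if F.lab q.2 = k ∧ F.lab (q.1 ∪ q.2)ᶜ = k ∧ (F.lab q.1 ≠ 0 ∧ F.lab q.1 ≠ 4 ∧ F.lab q.1 ≠ k) then (1 : ℤ) else 0)
        + (if F.lab (q.1 ∪ q.2)ᶜ = k ∧ F.lab q.1 = k ∧ (F.lab q.2 ≠ 0 ∧ F.lab q.2 ≠ 4 ∧ F.lab q.2 ≠ k) then (1 : ℤ) else 0)
        + (if F.lab (q.1 ∪ q.2)ᶜ = k ∧ F.lab q.2 = k ∧ (F.lab q.1 ≠ 0 ∧ F.lab q.1 ≠ 4 ∧ F.lab q.1 ≠ k) then (1 : ℤ) else 0)) := by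
    unfold NkkForeign
    exact sum_parts_symm6 (fun x y z => if x = k ∧ y = k ∧ (z ≠ 0 ∧ z ≠ 4 ∧ z ≠ k) then (1 : ℤ) else 0) F
  rw [← F.sum_spec_eq, e1, e2]
  unfold Ntri
  rw [← sum_sub_distrib, ← sum_sub_distrib]
  refine sum_congr rfl fun q _ => ?_
  exact petal_kernel_identity k hk0 hk4 (F.lab q.1) (F.lab q.2) (F.lab (q.1 ∪ q.2)ᶜ)

/-- Consequence: `Ntri + 6·NkkForeign k ≤ 6·Nabk k` — the rainbows and the `(k,k,j)` partitions are paid by the `(A,B,C_k)` partitions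
(antipodal Gladkov behind petal-`k` spectators). [this work] -/
theorem Ntri_le_six_Nabk (k : Fin 5) (hk0 : k ≠ 0) (hk4 : k ≠ 4) : F.Ntri + 6 * F.NkkForeign k ≤ 6 * F.Nabk k := by
  have h := F.three_Sw_petal_eq k hk0 hk4
  have hS : 0 ≤ F.Sw (fun v => if v = k then 1 else 0) := F.Sw_nonneg _ fun v => by split_ifs <;> norm_num
  linarith

/-- **The spectator-transfer inequality holds behind a CENTRED petal** (all petal-`0` sets, label `1`, contain a fixed nonempty set `c`):
`2·Nabk 1 ≤ SA + SB + 2·Nkk 1` — indeed `2·Nabk 1 = 2·N140 ≤ SB` by prim-l12-p2's `two_N140_le_SB_of_centered`. [this work] -/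
theorem spectatorTransfer_one_of_centered {c : Finset α} (hne : c.Nonempty) (hC : ∀ S ∈ F.V 0, S ∉ F.A → c ⊆ S) :
    2 * F.Nabk 1 ≤ F.SA + F.SB + 2 * F.Nkk 1 := by
  have h1 := F.two_N140_le_SB_of_centered hne hC
  have h2 := F.SA_nonneg
  have h3 := F.Nkk_nonneg 1
  rw [F.Nabk_one_eq_N140]
  linarith

/-! ## The block-weighted partition functional -/

/-- `ZHw w₁ w₂ w₃ = Σ_{(P¹,P²,P³)} s6H · w₁^{#P¹} · w₂^{#P²} · w₃^{#P³}` — the `H`-row partition functional under the i.i.d. block assignment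
with weights `(w₁,w₂,w₃)`. [this work] -/
def ZHw (w₁ w₂ w₃ : ℕ) : ℤ :=
  ∑ q ∈ parts α, s6H (F.lab q.1) (F.lab q.2) (F.lab (q.1 ∪ q.2)ᶜ) *
    ((w₁ ^ q.1.card * w₂ ^ q.2.card * w₃ ^ ((q.1 ∪ q.2)ᶜ).card : ℕ) : ℤ)

/-- `ZHw 1 1 1 = ZH`. [this work] -/
theorem ZHw_one : F.ZHw 1 1 1 = F.ZH := by
  unfold ZHw ZH
  exact sum_congr rfl fun q _ => by simp

end Sunflower

/-! ## The two typed conjectures and their reductions -/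

/-- **CONJECTURE `SpectatorTransfer`** (this work; OPEN; census-true, memo SPECTATOR-TRANSFER-GEN22 §2): for every finite sunflower of
up-sets and every petal label `k`, `2 · Nabk k ≤ SA + SB + 2 · Nkk k`.  Equivalently `ZH ≥ 3·Sw 1_{k} − 6·(Nkk k − NkkForeign k)`
(`ZH_ge_of_spectatorTransfer`).  Proved behind a centred petal (`Sunflower.spectatorTransfer_one_of_centered`).
An obligation, never a fact: use as `(h : SpectatorTransfer)`. [status: open] -/
@[conjecture] def SpectatorTransfer : Prop :=
  ∀ (α : Type) [Fintype α] [DecidableEq α] (F : Sunflower α) (k : Fin 5), k ≠ 0 → k ≠ 4 →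
    2 * F.Nabk k ≤ F.SA + F.SB + 2 * F.Nkk k

/-- **CONJECTURE `WeightedPartitionLemma`** (this work; OPEN; census-true, memo SPECTATOR-TRANSFER-GEN22 §3): `0 ≤ ZHw w₁ w₂ w₃` for every finite
sunflower of up-sets and all block weights `w₁, w₂, w₃ : ℕ`.  Strictly stronger than `PartitionLemmaH` (`partitionLemmaH_of_weighted`).
An obligation, never a fact: use as `(h : WeightedPartitionLemma)`. [status: open] -/
@[conjecture] def WeightedPartitionLemma : Prop :=
  ∀ (α : Type) [Fintype α] [DecidableEq α] (F : Sunflower α) (w₁ w₂ w₃ : ℕ), 0 ≤ F.ZHw w₁ w₂ w₃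

/-- `WeightedPartitionLemma ⇒ PartitionLemmaH` (take `w = (1,1,1)`). [this work] -/
theorem partitionLemmaH_of_weighted (h : WeightedPartitionLemma) : PartitionLemmaH := by
  intro α _ _ F
  rw [← F.ZHw_one]
  exact h α F 1 1 1

/-- **`SpectatorTransfer` in slack form**: `ZH ≥ 3·Sw 1_{k} − 6·(Nkk k − NkkForeign k)` for every petal label `k`. [this work] -/
theorem ZH_ge_of_spectatorTransfer (h : SpectatorTransfer) {α : Type} [Fintype α] [DecidableEq α] (F : Sunflower α)
    (k : Fin 5) (hk0 : k ≠ 0) (hk4 : k ≠ 4) :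
    3 * F.Sw (fun v => if v = k then 1 else 0) - 6 * (F.Nkk k - F.NkkForeign k) ≤ F.ZH := by
  have h1 := h α F k hk0 hk4
  have h2 := F.three_Sw_petal_eq k hk0 hk4
  rw [F.ZH_eq_SA_SB]
  linarith

/-- **★ behind an intersecting petal, quantitatively**: under `SpectatorTransfer`, if no ordered 3-partition has its first two blocks in petal `k`
(`Nkk k = 0`, e.g. petal `k` is an intersecting family), then `0 ≤ 3·Sw 1_{k} ≤ ZH`. [this work] -/
theorem ZH_nonneg_of_spectatorTransfer_of_Nkk_eq_zero (h : SpectatorTransfer) {α : Type} [Fintype α] [DecidableEq α]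
    (F : Sunflower α) (k : Fin 5) (hk0 : k ≠ 0) (hk4 : k ≠ 4) (hkk : F.Nkk k = 0) :
    0 ≤ 3 * F.Sw (fun v => if v = k then 1 else 0) ∧ 3 * F.Sw (fun v => if v = k then 1 else 0) ≤ F.ZH := by
  have hS : 0 ≤ F.Sw (fun v => if v = k then 1 else 0) := F.Sw_nonneg _ fun v => by split_ifs <;> norm_num
  have h1 := ZH_ge_of_spectatorTransfer h F k hk0 hk4
  have h2 := F.NkkForeign_le_Nkk k
  have h3 := F.NkkForeign_nonneg k
  refine ⟨by linarith, ?_⟩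
  rw [hkk] at h1
  linarith

end Summit.CriticalPhenomena.PercolationContinuityZ3.Theorems.SunflowerPartition
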